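import Mathlib.Tactic.Linarith
import Summits.CriticalPhenomena.PercolationContinuityZ3.Theorems.PercNearOneGluingNoHeavyLowerTailSahiCTCNcSplit
import HarnessLib

/-!
# `NoHeavyLowerTail` (crux stmt-CriticalPhenomena-4575), P3 lane: the level-split form `T_c` is nonnegative for NESTED skeleta —
# `h_X ⊆ h_Z ⇒ T_c(K_X,K_Z) ∈ ℕ[r]` (every `c`, every ground set), via the "top-level LYM" inequality `e_c·h_K − Θ_c·K_{=c} ∈ ℕ[r]`

Support file (seat `prim-l12-p3`, gen 23; `--supports stmt-CriticalPhenomena-4575`).  Memo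
`run/shared/lean/prim/prim-l12/FROM-prim-l12-p3-g23-LEVEL-SPLIT.md` §1.2.  Companion of `…SahiCTCNcSplit` (`Ñ_c = Π·T_c + e_c·R_c`,
`T_c = e_c·(Π·h_Y − h_X·h_Z) − Θ_c·D_c·e_Y`).

* `coeff_topLYM_sub_nonneg` : for a down-set `K` and any `c`, `e_c·GF(h_K) − Θ_c·GF(K_{=c}) ∈ ℕ[r]` (`h_K` = faces of size `≤ c`): the sum over
  `d ≤ c` of the single-level blocks `e_c·K_{=d} − e_d·K_{=c}` of `…SahiCTCDownLYM.coeff_downLYM_sub_nonneg` (the density of a down-set does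
  not increase from level `d` to level `c`).
* `coeff_TcForm_nonneg_of_nested` : if the `c`-skeleton of `K_X` is contained in that of `K_Z` (`facesLE c K_X ⊆ facesLE c K_Z`; in particular
  `K_X ⊆ K_Z`, or `K_X = K_Z`), then `T_c(K_X,K_Z) ∈ ℕ[r]`.  PROOF: then `h_Y = h_X`, `e_Y = (h_X)_{=c}` and `Π − h_Z = D_c + GF(small
  non-faces of K_Z)`, so `T_c = D_c·(e_c·h_X − Θ_c·(h_X)_{=c}) + e_c·h_X·GF(small non-faces of K_Z)` (`TcForm_eq_of_nested`), a sum of products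
  of polynomials with nonnegative coefficients.  With `Ngen_comm` the symmetric case `h_Z ⊆ h_X` follows (`coeff_TcForm_nonneg_of_nested'`).
This is the first infinite sub-case of the conjecture (LS_c) of the companion file beyond the Harris-block cases recorded there.  Nothing is
asserted about the crux.
-/

namespace Summit.CriticalPhenomena.PercolationContinuityZ3.Theorems.SahiCTCForms

open Finset MvPolynomial SahiCTCGenFun

variable {α : Type*} [DecidableEq α] [Fintype α]

/-! ### Top-level LYM: `e_c·h_K − Θ_c·K_{=c} ∈ ℕ[r]` -/

/-- **Top-level LYM for a down-set**: `e_c·GF(faces of size ≤ c) − Θ_c·GF(faces of size = c)` has nonnegative coefficients. [this work] -/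
theorem coeff_topLYM_sub_nonneg (c : ℕ) {K : Finset (Finset α)} (hK : IsLowerSet (K : Set (Finset α))) (n : α →₀ ℕ) :
    0 ≤ (ee c * gf (facesLE c K) - ThC c * gf (K.filter fun S => #S = c) : MvPolynomial α ℤ).coeff n := by
  have hKV : ∀ S ∈ K, S ⊆ (univ : Finset α) := fun S _ => subset_univ S
  have hVV : ∀ S ∈ (univ : Finset α).powerset, S ⊆ (univ : Finset α) := fun S _ => subset_univ S
  set R := range (#(univ : Finset α) + 1) with hR
  have e2 : gf (facesLE c K) = ∑ d ∈ R.filter (fun d => d ≤ c), gf (K.filter fun S => #S = d) := by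
    rw [facesLE_eq_filter]; exact gf_filter_card_eq_sum hKV (fun d => d ≤ c)
  have e3 : (ThC c : MvPolynomial α ℤ) = ∑ d ∈ R.filter (fun d => d ≤ c), gf (univ.powerset.filter fun P : Finset α => #P = d) := by
    unfold ThC bySize; exact gf_filter_card_eq_sum hVV (fun d => d ≤ c)
  unfold ee bySize
  rw [e2, e3, mul_sum, sum_mul, ← sum_sub_distrib, coeff_sum]
  refine sum_nonneg fun d hd => ?_
  have hd1 := (mem_filter.1 hd).2
  exact coeff_downLYM_sub_nonneg hK hd1 n

/-! ### `T_c` for nested skeleta -/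

/-- For nested skeleta the common small faces are the small faces of `K_X`. [this work] -/
theorem commonLE_eq_of_nested (c : ℕ) {KX KZ : Finset (Finset α)} (hsub : facesLE c KX ⊆ facesLE c KZ) :
    commonLE c KX KZ = facesLE c KX := by
  rw [commonLE_eq_inter]; exact inter_eq_left.2 hsub

/-- For nested skeleta the common `c`-faces are the `c`-faces of `K_X`. [this work] -/
theorem commonEQ_eq_of_nested (c : ℕ) {KX KZ : Finset (Finset α)} (hsub : facesLE c KX ⊆ facesLE c KZ) :
    commonEQ c KX KZ = KX.filter fun S => #S = c := by
  ext S
  simp only [commonEQ, mem_filter, mem_powerset, subset_univ, true_and]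
  constructor
  · rintro ⟨h1, h2, -⟩; exact ⟨h2, h1⟩
  · rintro ⟨h1, h2⟩
    refine ⟨h2, h1, ?_⟩
    have hS : S ∈ facesLE c KX := mem_filter.2 ⟨mem_powerset.2 (subset_univ _), by omega, h1⟩
    exact ((mem_filter.1 (hsub hS)).2).2

/-- The small non-faces of a family at level `c`: sets of size `≤ c` not in `K`. [this work] -/
theorem PiP_eq_facesLE_add (c : ℕ) (K : Finset (Finset α)) :
    (PiP : MvPolynomial α ℤ) = gf (facesLE c K) + DdC c + gf (univ.powerset.filter fun S : Finset α => #S ≤ c ∧ S ∉ K) := by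
  unfold PiP DdC bySize
  rw [← gf_union, ← gf_union]
  · congr 1
    ext S
    simp only [facesLE, mem_union, mem_filter, mem_powerset, subset_univ, true_and, true_iff]
    by_cases hc : #S ≤ c
    · by_cases hS : S ∈ K
      · exact Or.inl (Or.inl ⟨hc, hS⟩)
      · exact Or.inr ⟨hc, hS⟩
    · exact Or.inl (Or.inr (by omega))
  · rw [disjoint_left]
    intro S h1 h2
    rcases mem_union.1 h1 with h | h
    · exact (mem_filter.1 h2).2.2 (mem_filter.1 h).2.2
    · have := (mem_filter.1 h).2; have := (mem_filter.1 h2).2.1; omega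
  · rw [disjoint_left]
    intro S h1 h2
    have := (mem_filter.1 h1).2.1; have := (mem_filter.1 h2).2; omega

/-- **`T_c` for nested skeleta, closed form**: if `h_X ⊆ h_Z` then
`T_c = D_c·(e_c·h_X − Θ_c·(h_X)_{=c}) + e_c·h_X·GF(small non-faces of K_Z)`. [this work] -/
theorem TcForm_eq_of_nested (c : ℕ) {KX KZ : Finset (Finset α)} (hsub : facesLE c KX ⊆ facesLE c KZ) :
    TcForm c KX KZ = DdC c * (ee c * gf (facesLE c KX) - ThC c * gf (KX.filter fun S => #S = c)) +
      ee c * gf (facesLE c KX) * gf (univ.powerset.filter fun S : Finset α => #S ≤ c ∧ S ∉ KZ) := by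
  unfold TcForm
  rw [commonLE_eq_of_nested c hsub, commonEQ_eq_of_nested c hsub, PiP_eq_facesLE_add c KZ]
  ring

/-- **`T_c(K_X,K_Z) ∈ ℕ[r]` WHEN THE `c`-SKELETON OF `K_X` IS CONTAINED IN THAT OF `K_Z`** (`K_X` a down-set; every `c`, every ground
set) — in particular for `K_X ⊆ K_Z` and for `K_X = K_Z`. [this work] -/
theorem coeff_TcForm_nonneg_of_nested (c : ℕ) {KX KZ : Finset (Finset α)} (hKX : IsLowerSet (KX : Set (Finset α)))
    (hsub : facesLE c KX ⊆ facesLE c KZ) : ∀ n, 0 ≤ (TcForm c KX KZ).coeff n := by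
  obtain ⟨-, hec, -, hDd⟩ := coeff_PiP_ee_nonneg (α := α) c
  intro n
  rw [TcForm_eq_of_nested c hsub]
  exact cw_add (cw_mul hDd (coeff_topLYM_sub_nonneg c hKX)) (cw_mul (cw_mul hec (coeff_gf_nonneg _)) (coeff_gf_nonneg _)) n

/-- `T_c` is symmetric under `X ↔ Z`. [this work] -/
theorem TcForm_comm (c : ℕ) (KX KZ : Finset (Finset α)) : TcForm c KX KZ = TcForm c KZ KX := by
  unfold TcForm; rw [commonLE_comm c KZ KX, commonEQ_comm c KZ KX]; ring

/-- The symmetric case: `h_Z ⊆ h_X` (with `K_Z` a down-set) also gives `T_c ∈ ℕ[r]`. [this work] -/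
theorem coeff_TcForm_nonneg_of_nested' (c : ℕ) {KX KZ : Finset (Finset α)} (hKZ : IsLowerSet (KZ : Set (Finset α)))
    (hsub : facesLE c KZ ⊆ facesLE c KX) : ∀ n, 0 ≤ (TcForm c KX KZ).coeff n := by
  intro n; rw [TcForm_comm]; exact coeff_TcForm_nonneg_of_nested c hKZ hsub n

/-- In particular `T_c(K,K) ∈ ℕ[r]` for every down-set `K` and every `c`. [this work] -/
theorem coeff_TcForm_self_nonneg (c : ℕ) {K : Finset (Finset α)} (hK : IsLowerSet (K : Set (Finset α))) :
    ∀ n, 0 ≤ (TcForm c K K).coeff n :=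
  coeff_TcForm_nonneg_of_nested c hK Subset.rfl

end Summit.CriticalPhenomena.PercolationContinuityZ3.Theorems.SahiCTCForms
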